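import Mathlib.MeasureTheory.Integral.Average
import Mathlib.MeasureTheory.Integral.MeanInequalities
import Mathlib.MeasureTheory.Function.LpSeminorm.CompareExp
import Mathlib.MeasureTheory.Integral.Prod
import Literature.Analysis.FluidPDE.LocalTypeI
import Literature.Analysis.FunctionSpaces.PoincareGluing
import HarnessLib

/-!
# Lower semicontinuity of the Albritton–Barker pressure quantity `D` under weak `L^{3/2}` limits

Trunk T-FLUID (`Literature/Analysis/FluidPDE`), family NS; proofs layer over
`Literature/Analysis/FluidPDE/LocalTypeI.lean` (Albritton–Barker 2019, Thm 1.1, corrected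
rendering `Literature.Analysis.FluidPDE.AlbrittonBarkerTypeICharacterization`). No new
definitions.

In the proof of Thm 1.1 (A–B §3, reverse direction) the Type I bound `𝐈(u) < ∞` of the limit
`(u, p)` of the rescaled solutions "follows from (3.3)", the uniform bound
`sup_k 𝐈(v^{(k)}, Q(2)) < ∞`, by lower semicontinuity of the scaled quantities under the
convergences of Lemma 2.2. `LocalTypeILscVelocity.lean` treats `C` and `A` (strong `L³`
limits); this file treats the mean-free pressure quantity
`D(Q(z, r)) = r⁻² ∫_{Q(z,r)} |q - [q]_{x,r}(t')|^{3/2}` (`cknDOsc`) under the *weak* convergence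
`q^{(k)} ⇀ p` in `L^{3/2}` (tested against `L³`, as rendered in `SuitableCompactness`):

* `enorm_setAverage_rpow_le`: Jensen/Hölder for averages, `‖⨍_s f‖ₑ^p ≤ μ(s)⁻¹ ∫⁻_s ‖f‖ₑ^p`
  (`1 ≤ p`, the `rpow` form of `Literature.Analysis.FunctionSpaces.enorm_setAverage_mul_rpow_le`);
  `lintegral_enorm_setAverage_slice_rpow_le`, `memLp_setAverage_slice`: on a cylinder `I × B`
  the time-dependent average `(t, y) ↦ [f]_B(t)` has `∫ |[f]|^p ≤ ∫ |f|^p`;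
* `integral_setAverage_slice_mul_comm`: the averaging operator is symmetric,
  `∫ [f] g = ∫ f [g]` for `f ∈ L^{3/2}`, `g ∈ L³` of the cylinder (so `f ↦ f - [f]` is
  weak–weak continuous);
* `cknDOsc_le_of_tendsto_weakly`: if `q_k ⇀ p` weakly in `L^{3/2}(Q₀)`, `Q(z, r) ⊆ Q₀`, and
  `D(Q(z,r); q_k) ≤ M` for all `k`, then `D(Q(z,r); p) ≤ M`: with `P = p - [p]` and the test
  function `g = P / √|P| ∈ L³` (`P g = |P|^{3/2}`, `|g|³ = |P|^{3/2}`),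
  `∫ |P|^{3/2} = ∫ P g = lim ∫ (q_k - [q_k]) g ≤ (r² M)^{2/3} (∫ |P|^{3/2})^{1/3}` (Hölder).

## References

* D. Albritton, T. Barker, *On local Type I singularities of the Navier–Stokes equations and
  Liouville theorems*, J. Math. Fluid Mech. 21 (2019), arXiv:1811.00502, §1 (the quantity `D`)
  and §3 (proof of Thm 1.1, "(3.6) follows from (3.3)").
-/

noncomputable section

open MeasureTheory Set Function Filter Topology TopologicalSpace Metric
open scoped NNReal ENNReal

namespace Literature.Analysis.FluidPDE

/-! ### Averages: Jensen in `ℝ≥0∞` form -/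

section Average

variable {α : Type*} [MeasurableSpace α] {μ : Measure α} {s : Set α}

/-- **Jensen/Hölder for averages**, `rpow` form: for a set `s` of finite measure, a real
`1 ≤ p`, and an a.e.-strongly measurable real `f` on `s`, `‖⨍_s f‖ₑ ^ p ≤ μ(s)⁻¹ ∫⁻_s ‖f‖ₑ ^ p`.
This is `Literature.Analysis.FunctionSpaces.enorm_setAverage_mul_rpow_le`
(`‖⨍_s f‖ₑ μ(s)^{1/p} ≤ ‖f‖_{L^p(s)}`) raised to the power `p`; for `μ s = 0` both sides
vanish. [folklore] -/
theorem enorm_setAverage_rpow_le (hs : μ s ≠ ∞) {f : α → ℝ} {p : ℝ} (hp : 1 ≤ p)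
    (hf : AEStronglyMeasurable f (μ.restrict s)) :
    ‖⨍ x in s, f x ∂μ‖ₑ ^ p ≤ (μ s)⁻¹ * ∫⁻ x in s, ‖f x‖ₑ ^ p ∂μ := by
  have hp0 : 0 < p := one_pos.trans_le hp
  rcases eq_or_ne (μ s) 0 with hs0 | hs0
  · have h0 : μ.restrict s = 0 := Measure.restrict_eq_zero.2 hs0
    simp [h0, ENNReal.zero_rpow_of_pos hp0]
  have hp1 : (1 : ℝ≥0∞) ≤ ENNReal.ofReal p := ENNReal.one_le_ofReal.2 hp
  have h := FunctionSpaces.enorm_setAverage_mul_rpow_le hs hp1 hf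
  rw [ENNReal.toReal_ofReal hp0.le, eLpNorm_eq_lintegral_rpow_enorm_toReal
    (zero_lt_one.trans_le hp1).ne' ENNReal.ofReal_ne_top, ENNReal.toReal_ofReal hp0.le] at h
  have h2 := ENNReal.rpow_le_rpow h hp0.le
  rw [ENNReal.mul_rpow_of_nonneg _ _ hp0.le, ← ENNReal.rpow_mul, ← ENNReal.rpow_mul,
    one_div_mul_cancel hp0.ne', ENNReal.rpow_one, ENNReal.rpow_one] at h2
  calc ‖⨍ x in s, f x ∂μ‖ₑ ^ p = (μ s)⁻¹ * (‖⨍ x in s, f x ∂μ‖ₑ ^ p * μ s) := by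
        rw [mul_comm _ (μ s), ← mul_assoc, ENNReal.inv_mul_cancel hs0 hs, one_mul]
    _ ≤ (μ s)⁻¹ * ∫⁻ x in s, ‖f x‖ₑ ^ p ∂μ := by gcongr

end Average

/-! ### Ball averages on a cylinder `I × B(x₀, r)` -/

section Cylinder

variable {Y : Type*} [MeasureSpace Y] [SFinite (volume : Measure Y)] {I : Set ℝ} {B : Set Y}

/-- The restriction of the product measure to a cylinder `I × B` is the product of the
restrictions. [folklore] -/
theorem volume_restrict_prod_eq (I : Set ℝ) (B : Set Y) :
    (volume.restrict (I ×ˢ B) : Measure (ℝ × Y)) =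
      (volume.restrict I).prod (volume.restrict B) := by
  rw [Measure.prod_restrict, ← Measure.volume_eq_prod]

/-- The time-dependent average `(t, y) ↦ [f]_B(t) = ⨍_B f(t, y') dy'` of an a.e.-strongly
measurable function on the cylinder `I × B` is a.e.-strongly measurable there. [folklore] -/
theorem aestronglyMeasurable_setAverage_slice {f : ℝ → Y → ℝ}
    (hf : AEStronglyMeasurable (uncurry f) (volume.restrict (I ×ˢ B))) :
    AEStronglyMeasurable (fun w : ℝ × Y => ⨍ y in B, f w.1 y) (volume.restrict (I ×ˢ B)) := by
  rw [volume_restrict_prod_eq] at hf ⊢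
  have h := hf.integral_prod_right'
  simp only [uncurry_apply_pair] at h
  simp_rw [setAverage_eq]
  exact (h.const_smul ((volume : Measure Y).real B)⁻¹).comp_quasiMeasurePreserving
    Measure.quasiMeasurePreserving_fst

/-- **`L^p` bound for the time-dependent average.** On the cylinder `I × B`, `B` of finite
positive measure, `(t, y) ↦ [f]_B(t)` satisfies `∫ ‖[f]‖ₑ^p ≤ ∫ ‖f‖ₑ^p` for `1 ≤ p`
(Tonelli and `enorm_setAverage_rpow_le` slice-wise). [folklore] -/
theorem lintegral_enorm_setAverage_slice_rpow_le (hB0 : volume B ≠ 0) (hBtop : volume B ≠ ∞)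
    {f : ℝ → Y → ℝ} {p : ℝ} (hp : 1 ≤ p)
    (hf : AEStronglyMeasurable (uncurry f) (volume.restrict (I ×ˢ B))) :
    ∫⁻ w in I ×ˢ B, ‖⨍ y in B, f w.1 y‖ₑ ^ p ≤ ∫⁻ w in I ×ˢ B, ‖f w.1 w.2‖ₑ ^ p := by
  have hLm : AEMeasurable (fun w : ℝ × Y => ‖⨍ y in B, f w.1 y‖ₑ ^ p)
      ((volume.restrict I).prod (volume.restrict B)) := by
    have := (aestronglyMeasurable_setAverage_slice hf).aemeasurable.enorm.pow_const p
    rwa [volume_restrict_prod_eq] at this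
  rw [volume_restrict_prod_eq] at hf ⊢
  have hRm : AEMeasurable (fun w : ℝ × Y => ‖f w.1 w.2‖ₑ ^ p)
      ((volume.restrict I).prod (volume.restrict B)) := hf.aemeasurable.enorm.pow_const _
  rw [lintegral_prod _ hLm, lintegral_prod _ hRm]
  refine lintegral_mono_ae ?_
  filter_upwards [hf.prodMk_left] with t ht
  simp only [lintegral_const, Measure.restrict_apply_univ]
  calc ‖⨍ y in B, f t y‖ₑ ^ p * volume B
      ≤ ((volume B)⁻¹ * ∫⁻ y in B, ‖f t y‖ₑ ^ p) * volume B := by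
        gcongr
        exact enorm_setAverage_rpow_le hBtop hp ht
    _ = ∫⁻ y in B, ‖f t y‖ₑ ^ p := by
        rw [mul_comm, ← mul_assoc, ENNReal.mul_inv_cancel hB0 hBtop, one_mul]

/-- The time-dependent average of an `L^p` function on the cylinder is in `L^p` of the
cylinder, `1 ≤ p < ∞` (with `‖[f]‖_{L^p} ≤ ‖f‖_{L^p}`). [folklore] -/
theorem memLp_setAverage_slice (hB0 : volume B ≠ 0) (hBtop : volume B ≠ ∞) {f : ℝ → Y → ℝ}
    {p : ℝ≥0∞} (hp : 1 ≤ p) (hp' : p ≠ ∞) (hf : MemLp (uncurry f) p (volume.restrict (I ×ˢ B))) :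
    MemLp (fun w : ℝ × Y => ⨍ y in B, f w.1 y) p (volume.restrict (I ×ˢ B)) := by
  have hp0 : p ≠ 0 := (zero_lt_one.trans_le hp).ne'
  have hpr : 1 ≤ p.toReal := by
    have := ENNReal.toReal_mono hp' hp
    rwa [ENNReal.toReal_one] at this
  refine ⟨aestronglyMeasurable_setAverage_slice hf.aestronglyMeasurable,
    lt_of_le_of_lt ?_ hf.eLpNorm_lt_top⟩
  rw [eLpNorm_eq_lintegral_rpow_enorm_toReal hp0 hp',
    eLpNorm_eq_lintegral_rpow_enorm_toReal hp0 hp']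
  exact ENNReal.rpow_le_rpow
    (lintegral_enorm_setAverage_slice_rpow_le hB0 hBtop hpr hf.aestronglyMeasurable)
    (by positivity)

/-! ### Symmetry of the averaging operator -/

/-- Arithmetic of the exponent `3/2` in `ℝ≥0∞`: `1 ≤ 3/2`, `3/2 ≠ ∞`, `(3/2).toReal = 3/2`.
[folklore] -/
theorem threeHalves_facts :
    (1 : ℝ≥0∞) ≤ 3 / 2 ∧ (3 / 2 : ℝ≥0∞) ≠ ∞ ∧ (3 / 2 : ℝ≥0∞).toReal = 3 / 2 := by
  refine ⟨?_, ENNReal.div_ne_top (by norm_num) (by norm_num), ?_⟩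
  · rw [ENNReal.le_div_iff_mul_le (by norm_num) (by norm_num)]; norm_num
  · rw [ENNReal.toReal_div]; norm_num

/-- `(3/2)⁻¹ + 3⁻¹ = 1⁻¹` in `ℝ≥0∞`: the Hölder triple `(3/2, 3, 1)` (a copy, with a light
import closure, of `Literature.Analysis.FunctionSpaces.holderTriple_threeHalves_three`).
[folklore] -/
theorem holderTriple_threeHalves_three_one' : ENNReal.HolderTriple (3 / 2 : ℝ≥0∞) 3 1 := by
  constructor
  rw [ENNReal.inv_div (Or.inr (by norm_num)) (Or.inr (by norm_num)), inv_one,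
    show (3 : ℝ≥0∞)⁻¹ = 1 / 3 by rw [one_div], ENNReal.div_add_div_same,
    show (2 : ℝ≥0∞) + 1 = 3 by norm_num]
  exact ENNReal.div_self (by norm_num) (by norm_num)

/-- **The averaging operator is symmetric.** For `f ∈ L^{3/2}` and `g ∈ L³` of the cylinder
`I × B`, `∫ [f]_B(t) g(t, y) = ∫ f(t, y) [g]_B(t)` (both equal `∫_I |B|⁻¹ (∫_B f(t)) (∫_B g(t)) dt`
by Fubini). [folklore] -/
theorem integral_setAverage_slice_mul_comm (hB0 : volume B ≠ 0) (hBtop : volume B ≠ ∞)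
    {f g : ℝ → Y → ℝ} (hf : MemLp (uncurry f) (3 / 2) (volume.restrict (I ×ˢ B)))
    (hg : MemLp (uncurry g) 3 (volume.restrict (I ×ˢ B))) :
    ∫ w in I ×ˢ B, (⨍ y in B, f w.1 y) * g w.1 w.2 =
      ∫ w in I ×ˢ B, f w.1 w.2 * ⨍ y in B, g w.1 y := by
  haveI : ENNReal.HolderTriple (3 / 2 : ℝ≥0∞) 3 1 := holderTriple_threeHalves_three_one'
  have hfa := memLp_setAverage_slice hB0 hBtop threeHalves_facts.1 threeHalves_facts.2.1 hf
  have hga := memLp_setAverage_slice hB0 hBtop (by norm_num) (by norm_num) hg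
  have hint1 : Integrable (fun w : ℝ × Y => (⨍ y in B, f w.1 y) * g w.1 w.2)
      (volume.restrict (I ×ˢ B)) := hfa.integrable_mul hg
  have hint2 : Integrable (fun w : ℝ × Y => f w.1 w.2 * ⨍ y in B, g w.1 y)
      (volume.restrict (I ×ˢ B)) := hf.integrable_mul hga
  rw [volume_restrict_prod_eq] at hint1 hint2 ⊢
  rw [integral_prod _ hint1, integral_prod _ hint2]
  refine integral_congr_ae (Eventually.of_forall fun t => ?_)
  simp only
  rw [integral_const_mul, integral_mul_const, setAverage_eq, setAverage_eq, smul_eq_mul,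
    smul_eq_mul]
  ring

end Cylinder

/-! ### `D` is lower semicontinuous under weak `L^{3/2}` convergence -/

section D

variable {Q₀ : Set (ℝ × EuclideanSpace ℝ (Fin 3))} {r : ℝ} {z : ℝ × EuclideanSpace ℝ (Fin 3)}
  {q : ℕ → ℝ → EuclideanSpace ℝ (Fin 3) → ℝ} {p : ℝ → EuclideanSpace ℝ (Fin 3) → ℝ} {M : ℝ≥0∞}

/-- The algebra of the test function `g = P / √|P|`: `P g = |P|^{3/2}`. [folklore] -/
theorem mul_div_sqrt_abs_eq_rpow (x : ℝ) : x * (x / Real.sqrt |x|) = |x| ^ (3 / 2 : ℝ) := by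
  rcases eq_or_ne x 0 with rfl | hx
  · simp [Real.zero_rpow (by norm_num : (3 / 2 : ℝ) ≠ 0)]
  have hax : 0 < |x| := abs_pos.2 hx
  have hs : 0 < Real.sqrt |x| := Real.sqrt_pos.2 hax
  rw [show (3 / 2 : ℝ) = 1 + 1 / 2 by norm_num, Real.rpow_add hax, Real.rpow_one,
    ← Real.sqrt_eq_rpow, mul_div_assoc']
  rw [div_eq_iff hs.ne', mul_assoc, Real.mul_self_sqrt hax.le, ← abs_mul_abs_self x]

/-- The algebra of the test function `g = P / √|P|`: `|g| = |P|^{1/2}`, in the form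
`‖g‖ₑ ^ 3 = ‖P‖ₑ ^ (3/2)`. [folklore] -/
theorem enorm_div_sqrt_abs_rpow_three (x : ℝ) :
    ‖x / Real.sqrt |x|‖ₑ ^ (3 : ℝ) = ‖x‖ₑ ^ (3 / 2 : ℝ) := by
  rcases eq_or_ne x 0 with rfl | hx
  · simp
  have hax : 0 < |x| := abs_pos.2 hx
  have h1 : abs (x / Real.sqrt (abs x)) = Real.sqrt (abs x) := by
    rw [abs_div, abs_of_nonneg (Real.sqrt_nonneg _)]
    nth_rewrite 1 [← Real.mul_self_sqrt hax.le]
    rw [mul_div_assoc, div_self (Real.sqrt_pos.2 hax).ne', mul_one]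
  rw [Real.enorm_eq_ofReal_abs, Real.enorm_eq_ofReal_abs, h1,
    ENNReal.ofReal_rpow_of_nonneg (Real.sqrt_nonneg _) (by norm_num),
    ENNReal.ofReal_rpow_of_nonneg (abs_nonneg _) (by norm_num), Real.sqrt_eq_rpow,
    ← Real.rpow_mul hax.le]
  norm_num

/-- **`D(Q(z,r))` passes to weak `L^{3/2}` limits** (Albritton–Barker 2019, §3, the step
"(3.6) follows from (3.3)" for the quantity `D`). If `q_k, p ∈ L^{3/2}(Q₀)`, `q_k ⇀ p` weakly
(tested against every `g ∈ L³(Q₀)`: `∫_{Q₀} q_k g → ∫_{Q₀} p g`), `Q(z, r) ⊆ Q₀`, `r > 0`, and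
`D(Q(z,r); q_k) = r⁻² ∫_{Q(z,r)} |q_k - [q_k]_{x,r}(t)|^{3/2} ≤ M` for all `k`, then
`D(Q(z,r); p) ≤ M`. The mean-free parts converge weakly (the averaging operator is symmetric,
`integral_setAverage_slice_mul_comm`), and testing against `g = P / √|P|`, `P = p - [p]`, gives
`∫ |P|^{3/2} = lim ∫ (q_k - [q_k]) g ≤ (r² M)^{2/3} (∫ |P|^{3/2})^{1/3}` by Hölder.
[cite: AlbrittonBarker2019, §3] -/
theorem cknDOsc_le_of_tendsto_weakly (hr : 0 < r) (hQ : FluidPDE.parabolicCylinder r z ⊆ Q₀)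
    (hq : ∀ k, MemLp (uncurry (q k)) (3 / 2) (volume.restrict Q₀))
    (hp : MemLp (uncurry p) (3 / 2) (volume.restrict Q₀))
    (hconv : ∀ g : ℝ × EuclideanSpace ℝ (Fin 3) → ℝ, MemLp g 3 (volume.restrict Q₀) →
      Tendsto (fun k => ∫ w in Q₀, q k w.1 w.2 * g w) atTop (𝓝 (∫ w in Q₀, p w.1 w.2 * g w)))
    (hbound : ∀ k, cknDOsc r z (q k) ≤ M) : cknDOsc r z p ≤ M := by
  haveI : ENNReal.HolderTriple (3 / 2 : ℝ≥0∞) 3 1 := holderTriple_threeHalves_three_one'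
  set B := ball z.2 r with hB
  have hB0 : volume B ≠ 0 := (measure_ball_pos volume z.2 hr).ne'
  have hBtop : volume B ≠ ∞ := measure_ball_lt_top.ne
  set Q' := FluidPDE.parabolicCylinder r z with hQ'
  have hQ'm : MeasurableSet Q' := (FluidPDE.isOpen_parabolicCylinder r z).measurableSet
  set μ' : Measure (ℝ × EuclideanSpace ℝ (Fin 3)) := volume.restrict Q' with hμ'
  have hμle : μ' ≤ volume.restrict Q₀ := Measure.restrict_mono hQ le_rfl
  have hr2 : (ENNReal.ofReal r ^ 2) ≠ 0 := pow_ne_zero _ ((ENNReal.ofReal_pos.2 hr).ne')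
  have hr2' : (ENNReal.ofReal r ^ 2) ≠ ∞ := ENNReal.pow_ne_top ENNReal.ofReal_ne_top
  obtain ⟨h32, h32', h32r⟩ := threeHalves_facts
  have h320 : (3 / 2 : ℝ≥0∞) ≠ 0 := (zero_lt_one.trans_le h32).ne'
  -- restrictions to `Q'`
  have hq' : ∀ k, MemLp (uncurry (q k)) (3 / 2) μ' := fun k => MemLp.mono_measure hμle (hq k)
  have hp' : MemLp (uncurry p) (3 / 2) μ' := MemLp.mono_measure hμle hp
  -- the mean-free parts
  set P := fun w : ℝ × EuclideanSpace ℝ (Fin 3) => p w.1 w.2 - ⨍ y in B, p w.1 y with hPdef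
  set Pk := fun k (w : ℝ × EuclideanSpace ℝ (Fin 3)) => q k w.1 w.2 - ⨍ y in B, q k w.1 y
    with hPkdef
  have hPmem : MemLp P (3 / 2) μ' := hp'.sub (memLp_setAverage_slice hB0 hBtop h32 h32' hp')
  have hPkmem : ∀ k, MemLp (Pk k) (3 / 2) μ' := fun k =>
    (hq' k).sub (memLp_setAverage_slice hB0 hBtop h32 h32' (hq' k))
  -- `D` in terms of the mean-free parts
  have hD : ∀ f : ℝ → EuclideanSpace ℝ (Fin 3) → ℝ, cknDOsc r z f =
      (ENNReal.ofReal r ^ 2)⁻¹ * ∫⁻ w, ‖f w.1 w.2 - ⨍ y in B, f w.1 y‖ₑ ^ (3 / 2 : ℝ) ∂μ' :=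
    fun f => rfl
  set N := ∫⁻ w, ‖P w‖ₑ ^ (3 / 2 : ℝ) ∂μ' with hN
  have hNtop : N ≠ ∞ := by
    have h := hPmem.eLpNorm_lt_top
    rw [eLpNorm_eq_lintegral_rpow_enorm_toReal h320 h32', h32r] at h
    exact ((ENNReal.rpow_lt_top_iff_of_pos (by norm_num)).1 h).ne
  have hNk : ∀ k, ∫⁻ w, ‖Pk k w‖ₑ ^ (3 / 2 : ℝ) ∂μ' ≤ ENNReal.ofReal r ^ 2 * M := fun k =>
    (ENNReal.inv_mul_le_iff hr2 hr2').1 (by rw [← hD]; exact hbound k)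
  -- the test function `g = P / √|P|`
  set g : ℝ × EuclideanSpace ℝ (Fin 3) → ℝ := fun w => P w / Real.sqrt |P w| with hgdef
  have hgm : AEStronglyMeasurable g μ' :=
    (hPmem.1.aemeasurable.div
      (continuous_abs.measurable.comp_aemeasurable hPmem.1.aemeasurable).sqrt).aestronglyMeasurable
  have hg3 : ∫⁻ w, ‖g w‖ₑ ^ (3 : ℝ) ∂μ' = N :=
    lintegral_congr fun w => enorm_div_sqrt_abs_rpow_three _
  have hgmem : MemLp g 3 μ' := by
    refine ⟨hgm, ?_⟩
    rw [eLpNorm_eq_lintegral_rpow_enorm_toReal (by norm_num) (by norm_num), ENNReal.toReal_ofNat,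
      hg3]
    exact ENNReal.rpow_lt_top_of_nonneg (by norm_num) hNtop
  -- Step A: `∫ P g = N`
  have hA : ENNReal.ofReal (∫ w, P w * g w ∂μ') = N := by
    have hPg : ∀ w, P w * g w = |P w| ^ (3 / 2 : ℝ) := fun w => mul_div_sqrt_abs_eq_rpow (P w)
    have hint : Integrable (fun w => P w * g w) μ' := hPmem.integrable_mul hgmem
    have hnn : 0 ≤ᵐ[μ'] fun w => P w * g w :=
      Eventually.of_forall fun w => by simp only [Pi.zero_apply]; rw [hPg]; positivity
    rw [ofReal_integral_eq_lintegral_ofReal hint hnn]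
    refine lintegral_congr fun w => ?_
    rw [hPg, ← ENNReal.ofReal_rpow_of_nonneg (abs_nonneg _) (by norm_num),
      ← Real.enorm_eq_ofReal_abs]
  -- Step B: Hölder bound on the approximants
  have hB : ∀ k, ‖∫ w, Pk k w * g w ∂μ'‖ₑ ≤
      (ENNReal.ofReal r ^ 2 * M) ^ (2 / 3 : ℝ) * N ^ (1 / 3 : ℝ) := by
    intro k
    refine (enorm_integral_le_lintegral_enorm _).trans ?_
    have hH := ENNReal.lintegral_mul_le_Lp_mul_Lq μ'
      (Real.holderConjugate_iff.2 ⟨by norm_num, by norm_num⟩ : (3 / 2 : ℝ).HolderConjugate 3)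
      (hPkmem k).1.aemeasurable.enorm hgm.aemeasurable.enorm
    simp only [Pi.mul_apply] at hH
    calc ∫⁻ w, ‖Pk k w * g w‖ₑ ∂μ' = ∫⁻ w, ‖Pk k w‖ₑ * ‖g w‖ₑ ∂μ' := by
          simp_rw [enorm_mul]
      _ ≤ (∫⁻ w, ‖Pk k w‖ₑ ^ (3 / 2 : ℝ) ∂μ') ^ (1 / (3 / 2 : ℝ)) *
            (∫⁻ w, ‖g w‖ₑ ^ (3 : ℝ) ∂μ') ^ (1 / (3 : ℝ)) := hH
      _ ≤ (ENNReal.ofReal r ^ 2 * M) ^ (2 / 3 : ℝ) * N ^ (1 / 3 : ℝ) := by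
          rw [hg3, show (1 / (3 / 2 : ℝ)) = 2 / 3 by norm_num]
          gcongr
          exact hNk k
  -- Step C: the mean-free parts converge weakly, tested against `g`
  have hC : Tendsto (fun k => ∫ w, Pk k w * g w ∂μ') atTop (𝓝 (∫ w, P w * g w ∂μ')) := by
    set G := Q'.indicator fun w : ℝ × EuclideanSpace ℝ (Fin 3) => g w - ⨍ y in B, g (w.1, y)
      with hGdef
    have hga : MemLp (fun w : ℝ × EuclideanSpace ℝ (Fin 3) => ⨍ y in B, g (w.1, y)) 3 μ' :=
      memLp_setAverage_slice (f := fun t y => g (t, y)) hB0 hBtop (by norm_num) (by norm_num) hgmem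
    have hGmem : MemLp G 3 (volume.restrict Q₀) := by
      rw [hGdef, memLp_indicator_iff_restrict hQ'm, Measure.restrict_restrict hQ'm,
        inter_eq_left.2 hQ]
      exact hgmem.sub hga
    -- `∫ (f - [f]) g = ∫_{Q₀} f G` for `f ∈ L^{3/2}(Q')`
    have key : ∀ f : ℝ → EuclideanSpace ℝ (Fin 3) → ℝ, MemLp (uncurry f) (3 / 2) μ' →
        ∫ w, (f w.1 w.2 - ⨍ y in B, f w.1 y) * g w ∂μ' = ∫ w in Q₀, f w.1 w.2 * G w := by
      intro f hf
      set fa := fun w : ℝ × EuclideanSpace ℝ (Fin 3) => ⨍ y in B, f w.1 y with hfadef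
      set ga := fun w : ℝ × EuclideanSpace ℝ (Fin 3) => ⨍ y in B, g (w.1, y) with hgadef
      have hfa : MemLp fa (3 / 2) μ' := memLp_setAverage_slice hB0 hBtop h32 h32' hf
      have h1 : Integrable (uncurry f * g) μ' := hf.integrable_mul hgmem
      have h2 : Integrable (fa * g) μ' := hfa.integrable_mul hgmem
      have h3 : Integrable (uncurry f * ga) μ' := hf.integrable_mul hga
      have hsymm : ∫ w, (fa * g) w ∂μ' = ∫ w, (uncurry f * ga) w ∂μ' :=
        integral_setAverage_slice_mul_comm (I := Ioo (z.1 - r ^ 2) z.1) hB0 hBtop hf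
          (g := fun t y => g (t, y)) hgmem
      calc ∫ w, (f w.1 w.2 - ⨍ y in B, f w.1 y) * g w ∂μ'
          = ∫ w, (uncurry f * g) w ∂μ' - ∫ w, (fa * g) w ∂μ' := by
            rw [← integral_sub h1 h2]
            exact integral_congr_ae (Eventually.of_forall fun w => sub_mul _ _ _)
        _ = ∫ w, (uncurry f * g) w ∂μ' - ∫ w, (uncurry f * ga) w ∂μ' := by rw [hsymm]
        _ = ∫ w, f w.1 w.2 * (g w - ⨍ y in B, g (w.1, y)) ∂μ' := by
            rw [← integral_sub h1 h3]
            exact integral_congr_ae (Eventually.of_forall fun w => (mul_sub _ _ _).symm)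
        _ = ∫ w in Q₀, f w.1 w.2 * G w := by
            rw [hGdef]
            simp_rw [← indicator_mul_right Q' (fun w : ℝ × EuclideanSpace ℝ (Fin 3) => f w.1 w.2)
              (fun w => g w - ⨍ y in B, g (w.1, y))]
            rw [setIntegral_indicator hQ'm, inter_eq_right.2 hQ]
    have hlim := hconv G hGmem
    rw [← key p hp'] at hlim
    simpa only [← key _ (hq' _)] using hlim
  -- Step D: pass to the limit in the Hölder bound
  have hDlim : N ≤ (ENNReal.ofReal r ^ 2 * M) ^ (2 / 3 : ℝ) * N ^ (1 / 3 : ℝ) :=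
    calc N = ENNReal.ofReal (∫ w, P w * g w ∂μ') := hA.symm
      _ ≤ ‖∫ w, P w * g w ∂μ'‖ₑ := Real.ofReal_le_enorm _
      _ ≤ (ENNReal.ofReal r ^ 2 * M) ^ (2 / 3 : ℝ) * N ^ (1 / 3 : ℝ) :=
          le_of_tendsto' hC.enorm hB
  -- Step E: `N ≤ r² M`
  have hE : N ≤ ENNReal.ofReal r ^ 2 * M := by
    rcases eq_or_ne N 0 with hN0 | hN0
    · rw [hN0]; exact zero_le
    have h1 : N ^ (2 / 3 : ℝ) ≤ (ENNReal.ofReal r ^ 2 * M) ^ (2 / 3 : ℝ) := by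
      have h13 : N ^ (1 / 3 : ℝ) ≠ 0 := by
        intro h
        rcases ENNReal.rpow_eq_zero_iff.1 h with ⟨h0, -⟩ | ⟨-, hneg⟩
        · exact hN0 h0
        · norm_num at hneg
      have h13' : N ^ (1 / 3 : ℝ) ≠ ∞ := ENNReal.rpow_ne_top_of_nonneg (by norm_num) hNtop
      have e : N ^ (2 / 3 : ℝ) * N ^ (1 / 3 : ℝ) = N := by
        rw [← ENNReal.rpow_add _ _ hN0 hNtop]; norm_num
      rw [← ENNReal.mul_le_mul_iff_left h13 h13', e]
      exact hDlim
    have := ENNReal.rpow_le_rpow h1 (by norm_num : (0 : ℝ) ≤ 3 / 2)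
    rwa [← ENNReal.rpow_mul, ← ENNReal.rpow_mul, show (2 / 3 : ℝ) * (3 / 2) = 1 by norm_num,
      ENNReal.rpow_one, ENNReal.rpow_one] at this
  rw [hD p]
  exact (ENNReal.inv_mul_le_iff hr2 hr2').2 hE

end D

end Literature.Analysis.FluidPDE
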